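import Literature.AlgebraicGeometry.Frobenioids.Thm36SubProofs2
import Literature.AlgebraicGeometry.Frobenioids.Thm36SubProofs
import Literature.AlgebraicGeometry.Frobenioids.ModelFrobenioidAmpleness
import Literature.AlgebraicGeometry.Frobenioids.ArchimedeanIstrProofs
import Literature.AnabelianGeometry.EtaleTheta.RealificationOrder
import HarnessLib

/-!
# Frobenioids II, Theorem 3.6 (i) for `C^ℝ := C^rlf` — typology of THE realification

Mochizuki, *The geometry of Frobenioids II*, Kyushu J. Math. **62** (2008) 401–460, Theorem 3.6 (i) p. 36
("the Frobenioid `C^Λ` is of `Aut`-ample, `Aut^sub`-ample, `End`-ample, and metrically trivial type, but not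
of group-like type"; "`(C^Λ)^istr` is of isotropic, base-trivial […] type"), at `Λ = ℝ`,
`C^ℝ := C^rlf` (Example 3.3 (ii) p. 28) — PROOF-ONLY companion
#3 of `Thm36Sub.lean` (abc-iut cell, L1 row M13).  `C^rlf` is the model Frobenioid ([FrdI] Thm. 5.2) of
`(Φ^rlf, ℝ · Φ^birat)` ([FrdI] Prop. 5.3); for the archimedean `Φ = ℝ_{≥0}|_D` the pull-backs of `Φ^rlf` are
identities (`Thm36Sub.rlfMap_Φ_eq_id`) and `ℝ · Φ^birat = (Φ^rlf)^gp` (`Thm36Sub.realSpan_carrier_eq_top`), so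
the model-Frobenioid mechanisms of [FrdII] Thm. 1.2 (seat abc-iut-L1-t2, `ModelFrobenioidAmpleness`) apply
verbatim: closes the slots `Thm36Sub.ampleTypes_R` (over a connected base, as in Ex. 3.3 (i)) and
`Thm36Sub.istrTypes_R` ((iv) for `C^ℝ` is `Thm36SubAutActionR.lean`, seat abc-iut-L1-d5).  Theorems only; no
side taken on [IUTchIII] Cor. 3.12.
-/

noncomputable section

namespace Literature.AlgebraicGeometry.Frobenioids

open CategoryTheory Opposite Literature.AnabelianGeometry.EtaleTheta
open scoped NNReal

universe v u

namespace ArchFrd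

namespace Thm36Sub

variable {D : Type u} [Category.{v} D] (π : D ⥤ D0)

/-! ### `End_D(A_D)` acts trivially on `Φ^rlf(A_D)`; `Div_B` of `C^rlf` is onto -/

/-- Every endomorphism (indeed every morphism) of `D` acts as the identity on `Φ^rlf` (the hypothesis
`hend` of [FrdII] Thm. 1.2 (i) for the model Frobenioid `C^rlf`). [cite: MochizukiFrdII2008, Thm 3.6 (i) p.36] -/
theorem rlf_endTrivial ⦃A : D⦄ (g : A ⟶ A) :
    (rlfFunctor (Φ π) (PreFrobenioid.IsPerfFactorialOn.op (isPerfFactorialOn_Φ π))).map g.op = 𝟙 _ := by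
  apply CommMonCat.hom_ext
  rw [rlfFunctor_map_hom, rlfMap_Φ_eq_id, CommMonCat.hom_id]
  rfl

/-- `Div_B : (ℝ · Φ^birat)(A) ↪ (Φ^rlf)^gp(A)` is onto for the archimedean Frobenioid
(`realSpan_carrier_eq_top`). [cite: MochizukiFrdI2008, Prop. 5.3 p.103] -/
theorem rlf_divB_surjective (A : D) :
    Function.Surjective
      (divB
        (RealificationData.canonical (Φ π)
            (PreFrobenioid.IsPerfFactorialOn.op (isPerfFactorialOn_Φ π))).rlf
        ((RealificationData.canonical (Φ π)
            (PreFrobenioid.IsPerfFactorialOn.op (isPerfFactorialOn_Φ π))).realSpan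
          (PreFrobenioid.biratSubfunctor (C.toElem π))).toMonoid
        ((RealificationData.canonical (Φ π)
            (PreFrobenioid.IsPerfFactorialOn.op (isPerfFactorialOn_Φ π))).realSpan
          (PreFrobenioid.biratSubfunctor (C.toElem π))).incl (op A)) := by
  intro γ
  have hγ : γ ∈ ((RealificationData.canonical (Φ π)
        (PreFrobenioid.IsPerfFactorialOn.op (isPerfFactorialOn_Φ π))).realSpan
      (PreFrobenioid.biratSubfunctor (C.toElem π))).carrier A := by
    rw [realSpan_carrier_eq_top]; exact Subgroup.mem_top _
  exact ⟨⟨γ, hγ⟩, rfl⟩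

/-! ### Theorem 3.6 (i), typology clauses, for `C^ℝ` -/

/-- `C^rlf` is of `Aut`-ample type: `g ∈ Aut_D(A_D)` lifts to `(1, g, 0, 1)` ([FrdII] Thm. 1.2 (i) mechanism,
`End_D(A_D)` acting trivially on `Φ^rlf(A_D)`). [cite: MochizukiFrdII2008, Thm 3.6 (i) p.36] -/
theorem rlf_isAutAmple (X : rlfCat π) : PreFrobenioid.IsAutAmple (rlfStr π) X :=
  ModelFrobenioid.isAutAmple_of_endTrivial (rlf_endTrivial π) X

/-- `C^rlf` is of `Aut^sub`-ample type ([FrdII] Thm. 1.2 (i) mechanism). [cite: MochizukiFrdII2008, Thm 3.6 (i) p.36] -/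
theorem rlf_isAutSubAmple (X : rlfCat π) : PreFrobenioid.IsAutSubAmple (rlfStr π) X :=
  ModelFrobenioid.isAutSubAmple_of_endTrivial (rlf_endTrivial π) X

/-- `C^rlf` is of `End`-ample type: `Div_B` is onto, so every `g ∈ End_D(A_D)` lifts to `(1, g, 0, u)`
([FrdII] Thm. 1.2 (i) cofinality mechanism). [cite: MochizukiFrdII2008, Thm 3.6 (i) p.36] -/
theorem rlf_isEndAmple (X : rlfCat π) : PreFrobenioid.IsEndAmple (rlfStr π) X := by
  refine ModelFrobenioid.isEndAmple_of_cofinal (fun A γ => ?_) X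
  obtain ⟨u, hu⟩ := rlf_divB_surjective π A γ⁻¹
  refine ⟨1, u, ?_⟩
  rw [map_one]
  exact (congrArg (γ * ·) hu).trans (mul_inv_cancel γ)

/-- `C^rlf` is of base-trivial type (ALL objects): `ℝ · Φ^birat` is group-like and `Div_B` is onto, so
base-isomorphic objects are isomorphic by `(1, g⁻¹, 0, u)` ([FrdII] Thm. 1.2 (v) mechanism).
[cite: MochizukiFrdII2008, Thm 3.6 (i) p.36] -/
theorem rlf_isBaseTrivial (X : rlfCat π) : PreFrobenioid.IsBaseTrivial (rlfStr π) X :=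
  ModelFrobenioid.isBaseTrivial_of_divB_surjective (fun _ b => GpSubfunctor.isUnit_toMonoid _ _ b)
    (rlf_divB_surjective π) X

/-- `C^rlf` is of metrically trivial type: a pre-step `X → Y` is a base-isomorphism, and `C^rlf` is of
base-trivial type. [cite: MochizukiFrdII2008, Thm 3.6 (i) p.36] -/
theorem rlf_isMetricallyTrivial (X : rlfCat π) : PreFrobenioid.IsMetricallyTrivial (rlfStr π) X := by
  intro Y ψ _ hψ
  haveI : IsIso (PreFrobenioid.Base (rlfStr π) ψ) := hψ.2
  exact rlf_isBaseTrivial π X Y ⟨asIso (PreFrobenioid.Base (rlfStr π) ψ)⟩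

/-- `Φ^rlf(X) ≠ 0`: the image of `1 ∈ ℝ_{≥0} = Φ(X)` under `Φ(X) → Φ(X)^pf → Φ^rlf(X)` is non-trivial
(`M^pf ↪ M^rlf` is an order embedding, [EtTh] Lem. 3.5 / [FrdI] Def. 2.4 (i)(c)).
[cite: MochizukiFrdI2008, Def. 2.4 (i) p.47] -/
theorem toRlf_of_one_ne_one (X : Dᵒᵖ) :
    ((PreFrobenioid.IsPerfFactorialOn.op (isPerfFactorialOn_Φ π)) X).toRealification
        (Perfection.of _ (Multiplicative.ofAdd (1 : ℝ≥0))) ≠ 1 := by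
  intro h1
  have hb : ∀ 𝔮 : Primes (Perfection ((Φ π).obj X)), IsMonoprime (PfAt ((Φ π).obj X) 𝔮) :=
    fun 𝔮 => IsMonoprime.ofR (RSupported.isRMonoprime_pfAt (supports_R_nnreal) 𝔮)
  have hdvd : Perfection.of ((Φ π).obj X) (Multiplicative.ofAdd (1 : ℝ≥0)) ∣ 1 := by
    rw [← RlfCoord.toRealification_dvd_iff
      ((PreFrobenioid.IsPerfFactorialOn.op (isPerfFactorialOn_Φ π)) X) hb, h1]
    exact one_dvd _
  obtain ⟨c, hc⟩ := hdvd
  obtain ⟨m, rfl⟩ := (isPerfect_iff_bijective_of.mp isPerfect_multiplicative_nnreal).2 c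
  have h2 : Multiplicative.ofAdd (1 : ℝ≥0) * m = 1 := by
    apply (isPerfect_iff_bijective_of.mp isPerfect_multiplicative_nnreal).1
    rw [MonoidHom.map_mul, MonoidHom.map_one]
    exact hc.symm
  have h3 := congrArg Multiplicative.toAdd h2
  rw [toAdd_mul, toAdd_ofAdd, toAdd_one] at h3
  exact one_ne_zero (add_eq_zero.mp h3).1

/-- `C^rlf` is NOT of group-like type over a base with an object (here: `D` connected, the standing
hypothesis of Example 3.3 (i)): `Φ^rlf(B) ≠ 0`. [cite: MochizukiFrdII2008, Thm 3.6 (i) p.36] -/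
theorem rlf_not_isOfType_isGroupLikeObj (hD : IsGraphConnected D) :
    ¬ PreFrobenioid.IsOfType (PreFrobenioid.IsGroupLikeObj (rlfStr π)) := by
  obtain ⟨⟨B⟩, -⟩ := hD
  intro h
  exact toRlf_of_one_ne_one π (op B) (h (⟨B, 1⟩ : rlfCat π) _)

/-- **Thm. 3.6 (i), typology clauses, for `C^ℝ = C^rlf`** (p. 36; `D` connected as in Ex. 3.3 (i)): "the
Frobenioid `C^Λ` is of `Aut`-ample, `Aut^sub`-ample, `End`-ample, and metrically trivial type, but not of
group-like type", `Λ = ℝ`, over THE realification — closes the slot `Thm36Sub.ampleTypes_R`.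
[cite: MochizukiFrdII2008, Thm 3.6 (i) p.36] -/
theorem ampleTypes_R_holds (hD : IsGraphConnected D) :
    Literature.AlgebraicGeometry.Frobenioids.ArchFrd.Thm36Sub.ampleTypes_R π :=
  ⟨rlf_isAutAmple π, rlf_isAutSubAmple π, rlf_isEndAmple π, rlf_isMetricallyTrivial π,
    rlf_not_isOfType_isGroupLikeObj π hD⟩

/-! ### Theorem 3.6 (i), `(C^ℝ)^istr` is of isotropic, base-trivial type -/

/-- **Thm. 3.6 (i) for `C^ℝ = C^rlf`** (p. 36): "The Frobenioid `(C^Λ)^istr` is of isotropic, base-trivial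
[…] type", `Λ = ℝ`, over THE realification (`(C^ℝ)^istr = C^ℝ`; isotropic type is generic for `F^istr`,
base-triviality is `rlf_isBaseTrivial` reflected along the full embedding) — closes the slot
`Thm36Sub.istrTypes_R`. [cite: MochizukiFrdII2008, Thm 3.6 (i) p.36] -/
theorem istrTypes_R_holds : Literature.AlgebraicGeometry.Frobenioids.ArchFrd.Thm36Sub.istrTypes_R π := by
  refine ⟨ArchFrd.isOfIsotropicType_istr (rlfStr π), fun A B hAB => ?_⟩
  obtain ⟨e⟩ := hAB
  obtain ⟨i⟩ := rlf_isBaseTrivial π A.obj B.obj ⟨e⟩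
  exact ⟨(PreFrobenioid.isotropicObjects (rlfStr π)).fullyFaithfulι.preimageIso i⟩

end Thm36Sub

end ArchFrd

end Literature.AlgebraicGeometry.Frobenioids
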